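import Summits.ValiantsHypothesis.ValiantsHypothesis.Theorems.KPlusLogSqLawValuativeDoorTameNested

/-!
# LINE `valuative_door` (crux `WeakLifting`, stmt-ValiantsHypothesis-19561) — THE TAME-PROGRESSION LAW (all `K`, ALL symmetric letters):
# `npEdges ≤ 3K − 4` on EVERY injective support unless a three-term-progression class cancels

HONEST FRAMING.  Helper (cell `pub-symmetroid`, seat val-sym-lift-p1 g25, 2026-08-29; `--supports 19561 --as helper`).  Width two, ALL `K`,
every field, raw `domCount` predicate.  `valProgressionTame_unfolded`: a symmetric `2 × 2` lacunary pencil on an injective support whose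
every progression class `2 d_z = d_x + d_w` is TAME (`v(det S_z), v(G_{xw}) ≤ v(f_{2d_z})`: the class sum does not cancel at its top) has
`npEdges ≤ 3K − 4`, the Sidon value (✓ `valSidonTwo_unfolded`, sharp ✓ `valSidonTwo_sharp_unfolded`).  Final form of the width-two
dichotomy (g24 ✓ `valProgressionFree_unfolded`, this seat ✓ `valAPFree_unfolded` = the corollary with no progression at all): **growth of
the symmetric width-two valuative row beyond `3K − 4` requires a progression CLASS whose top cancels** — the mechanism of the
✓ `valNonSidonFive_unfolded` witness (`0 + 8 = 4 + 4`, `14 > 12`); four-letter coincidences and singular letters are irrelevant.  Proof =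
the AP-free proof run through non-doubled classes (✓ `…TameEngine`, ✓ `…TameRoof`); the nested-pair exclusion is ✓ `not_nested_leading_of_tame`
(`…TameNested`); here the count (`domCount_le_of_tame_sorted`) and the sorting.  Nothing here is a stub of the line or closes anything;
no bearing on vW / vB, `TropicalB`, `MatrixDescartes` (18050) or VP ≠ VNP.  [roof + Gram rank 3 + max-excess propagation]
-/

set_option linter.dupNamespace false
set_option autoImplicit false

namespace Summit.ValiantsHypothesis.ValiantsHypothesis.Theorems.KPlusLogSqLaw.ValDoor

open Polynomial Finset Matrix
open scoped BigOperators Classical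

variable {F : Type*} [Field F]

/-! ## §1 The count for sorted letters -/

/-- **at most `(2K − 3) + K` dominant exponents** for a symmetric `2 × 2` pencil with strictly increasing exponents whose progression
classes are tame, ALL letters: every dominant class is tame (roof-excess lemma with the roof of two dominant classes), so it has a
LEADING pair; leading pairs are never nested (`not_nested_leading_of_tame`), so they form a chain of at most `2K − 3`
(✓ `card_le_of_pairChain`); the diagonal contributes at most `K`. [assembly] -/
theorem domCount_le_of_tame_sorted (v : AbsoluteValue F ℝ) (hv : IsNonarchimedean v) {K : ℕ} (d : Fin K → ℕ) (hd : StrictMono d)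
    (S : Fin K → Matrix (Fin 2) (Fin 2) F) (hS : ∀ l, (S l).IsSymm)
    (hT : ∀ z x w : Fin K, x < w → d x + d w = d z + d z →
      v (S z 0 0 * S z 1 1 - S z 0 1 * S z 0 1)
          ≤ v ((Matrix.det (∑ l, ((X : F[X]) ^ d l) • (S l).map (C : F →+* F[X]))).coeff (d z + d z)) ∧
        v (S x 0 0 * S w 1 1 + S w 0 0 * S x 1 1 - 2 * S x 0 1 * S w 0 1)
          ≤ v ((Matrix.det (∑ l, ((X : F[X]) ^ d l) • (S l).map (C : F →+* F[X]))).coeff (d z + d z))) :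
    ((Matrix.det (∑ l, ((X : F[X]) ^ d l) • (S l).map (C : F →+* F[X]))).support.filter fun E =>
        ∃ r : ℝ, 0 < r ∧ ∀ E' ∈ (Matrix.det (∑ l, ((X : F[X]) ^ d l) • (S l).map (C : F →+* F[X]))).support, E' ≠ E →
          v ((Matrix.det (∑ l, ((X : F[X]) ^ d l) • (S l).map (C : F →+* F[X]))).coeff E') * r ^ E'
            < v ((Matrix.det (∑ l, ((X : F[X]) ^ d l) • (S l).map (C : F →+* F[X]))).coeff E) * r ^ E).card
      ≤ (2 * K - 3) + K := by
  set f : F[X] := Matrix.det (∑ l, ((X : F[X]) ^ d l) • (S l).map (C : F →+* F[X])) with hf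
  set Gm : Fin K → Fin K → F := fun i j => S i 0 0 * S j 1 1 + S j 0 0 * S i 1 1 - 2 * S i 0 1 * S j 0 1 with hGm
  set D := f.support.filter fun E => ∃ r : ℝ, 0 < r ∧ ∀ E' ∈ f.support, E' ≠ E →
      v (f.coeff E') * r ^ E' < v (f.coeff E) * r ^ E with hD
  -- zero or one dominant class
  by_cases hD1 : ∀ E ∈ D, ∀ E' ∈ D, E = E'
  · rcases D.eq_empty_or_nonempty with h0 | ⟨E₀, hE₀⟩
    · rw [h0, Finset.card_empty]; exact Nat.zero_le _
    · have hDs : D = {E₀} := Finset.eq_singleton_iff_unique_mem.2 ⟨hE₀, fun E hE => hD1 E hE E₀ hE₀⟩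
      rw [hDs, Finset.card_singleton]
      have hne0 := Polynomial.mem_support_iff.1 (Finset.mem_filter.1 hE₀).1
      rw [hf, coeff_det_symmPencil_two d S hS] at hne0
      obtain ⟨p, -, -⟩ := Finset.exists_ne_zero_of_sum_ne_zero hne0
      have hK : 0 < K := Fin.pos p.1
      omega
  push Not at hD1
  obtain ⟨E₁, hE₁, E₂, hE₂, hne12⟩ := hD1
  -- every dominant class is tame: its entries are `v`-bounded by its coefficient
  have hDtame : ∀ E ∈ D, ∀ i j : Fin K, d i + d j = E → Gm i j ≠ 0 → v (Gm i j) ≤ v (f.coeff E) := by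
    intro E hE i j hij hG
    obtain ⟨E', hE', hEE'⟩ : ∃ E' ∈ D, E' ≠ E := by
      by_cases h1 : E₁ = E
      · exact ⟨E₂, hE₂, fun h2 => hne12 (h1.trans h2.symm)⟩
      · exact ⟨E₁, hE₁, h1⟩
    obtain ⟨hEsupp, hEdom⟩ := Finset.mem_filter.1 hE
    obtain ⟨hE'supp, hE'dom⟩ := Finset.mem_filter.1 hE'
    obtain ⟨sB, hsB⟩ := (exists_dominant_iff_exists_slope v f hEsupp).1 hEdom
    obtain ⟨sC, hsC⟩ := (exists_dominant_iff_exists_slope v f hE'supp).1 hE'dom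
    set ℓ : ℕ → ℝ := fun E => Real.log (v (f.coeff E)) with hℓ
    have hmaj : ∀ E'' ∈ f.support, Real.log (v (f.coeff E''))
        ≤ min (ℓ E + (E : ℝ) * sB + (-sB) * (E'' : ℝ)) (ℓ E' + (E' : ℝ) * sC + (-sC) * (E'' : ℝ)) := by
      intro E'' hE''
      refine le_min ?_ ?_
      · by_cases h0 : E'' = E
        · rw [h0]; simp only [hℓ]; linarith
        · have := hsB E'' hE'' h0; simp only [hℓ]; linarith
      · by_cases h0 : E'' = E'
        · rw [h0]; simp only [hℓ]; linarith
        · have := hsC E'' hE'' h0; simp only [hℓ]; linarith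
    have h := log_polar_le_roof_of_tame v hv d hd S hS hT (ℓ E + (E : ℝ) * sB) (-sB) (ℓ E' + (E' : ℝ) * sC) (-sC) hmaj i j hG
    have h2 : Real.log (v (Gm i j)) ≤ ℓ E := by
      refine h.trans ((min_le_left _ _).trans (le_of_eq ?_))
      rw [hij]; ring
    exact (Real.log_le_log_iff (v.pos hG) (v.pos (Polynomial.mem_support_iff.1 hEsupp))).1 h2
  -- leading off-diagonal pairs of dominant classes, and the diagonal
  set Doff : Finset (Fin K × Fin K) := (univ : Finset (Fin K × Fin K)).filter fun p =>
    p.1 < p.2 ∧ d p.1 + d p.2 ∈ D ∧ v (Gm p.1 p.2) = v (f.coeff (d p.1 + d p.2)) with hDoff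
  set Diag : Finset ℕ := (univ : Finset (Fin K)).image fun i => d i + d i with hDiag
  have hcover : D ⊆ Doff.image (fun p => d p.1 + d p.2) ∪ Diag := by
    intro E hE
    rw [Finset.mem_union]
    by_cases hdiagE : ∃ i, d i + d i = E
    · right
      obtain ⟨i, hi⟩ := hdiagE
      exact Finset.mem_image.2 ⟨i, Finset.mem_univ _, hi⟩
    left
    push Not at hdiagE
    have hEsupp : E ∈ f.support := (Finset.mem_filter.1 hE).1
    have hne := Polynomial.mem_support_iff.1 hEsupp
    have hsum := coeff_eq_sum_polar d S hS hdiagE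
    set T := (univ : Finset (Fin K × Fin K)).filter (fun p => p.1 < p.2 ∧ d p.1 + d p.2 = E) with hT
    have hTne : T.Nonempty := by
      by_contra h0
      rw [Finset.not_nonempty_iff_eq_empty] at h0
      apply hne
      rw [hf, hsum, h0, Finset.sum_empty]
    obtain ⟨p, hp, hle⟩ := IsNonarchimedean.finset_image_add_of_nonempty hv
      (fun p : Fin K × Fin K => S p.1 0 0 * S p.2 1 1 + S p.2 0 0 * S p.1 1 1 - 2 * S p.1 0 1 * S p.2 0 1) hTne
    rw [← hsum] at hle
    obtain ⟨-, hp1, hp2⟩ := Finset.mem_filter.1 hp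
    have hle' : v (f.coeff E) ≤ v (Gm p.1 p.2) := hle
    have hG : Gm p.1 p.2 ≠ 0 := by
      intro h0
      rw [h0, map_zero] at hle'
      exact hne (v.eq_zero.1 (le_antisymm hle' (v.nonneg _)))
    have hge := hDtame E hE p.1 p.2 hp2 hG
    refine Finset.mem_image.2 ⟨p, Finset.mem_filter.2 ⟨Finset.mem_univ _, hp1, ?_, ?_⟩, hp2⟩
    · rw [hp2]; exact hE
    · rw [hp2]; exact le_antisymm hge hle'
  -- leading pairs form a chain
  have hchain : ∀ p ∈ Doff, ∀ p' ∈ Doff, p.1 < p'.1 → p.2 ≤ p'.2 := by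
    intro p hp p' hp' h1
    obtain ⟨-, hp12, hpD, hpv⟩ := Finset.mem_filter.1 hp
    obtain ⟨-, hp12', hpD', hpv'⟩ := Finset.mem_filter.1 hp'
    by_contra h2
    push Not at h2
    exact not_nested_leading_of_tame v hv d hd S hS hT h1 hp12' h2
      (Finset.mem_filter.1 hpD) (Finset.mem_filter.1 hpD') hpv hpv'
  have hoff : Doff.card ≤ 2 * K - 3 := by
    have h := card_le_of_pairChain 0 Doff (fun p hp => by simpa using (Finset.mem_filter.1 hp).2.1) hchain
    simpa using h
  have hdiag : Diag.card ≤ K := Finset.card_image_le.trans (by rw [Finset.card_univ, Fintype.card_fin])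
  calc D.card ≤ (Doff.image (fun p => d p.1 + d p.2) ∪ Diag).card := Finset.card_le_card hcover
    _ ≤ (Doff.image fun p => d p.1 + d p.2).card + Diag.card := Finset.card_union_le _ _
    _ ≤ Doff.card + K := Nat.add_le_add Finset.card_image_le hdiag
    _ ≤ (2 * K - 3) + K := Nat.add_le_add_right hoff K

/-! ## §2 The tame-progression law, unfolded -/

/-- **THE TAME-PROGRESSION LAW (all `K`, ALL symmetric letters, every non-archimedean field), UNFOLDED.**  A symmetric `2 × 2` lacunary
pencil `Σ_l X^{d_l} S_l` on an injective support whose every THREE-TERM-PROGRESSION CLASS `2 d_z = d_x + d_w` (`x ≠ w`) is TAME — the letter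
determinant `det S_z` and the polarised entry `G_{xw} = a_x c_w + a_w c_x − 2 b_x b_w` are `v`-bounded by the class coefficient — has at most
`(2K − 3) + K` dominant exponents: `npEdges ≤ 3K − 4`, the Sidon value.  Equivalently: **the width-two symmetric valuative row exceeds
`3K − 4` only through a CANCELLING progression class** (✓ `valNonSidonFive_unfolded`: `(0,3,4,8,14)`, class `8 = 0 + 8 = 4 + 4`, `14 > 12`).
Corollaries: ✓ `valAPFree_unfolded` (no progression), ✓ `valSidonTwo_unfolded`. [sorting + `domCount_le_of_tame_sorted`] -/
theorem valProgressionTame_unfolded :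
    ∀ (F : Type) [Field F] (v : AbsoluteValue F ℝ), IsNonarchimedean v →
      ∀ (K : ℕ) (d : Fin K → ℕ) (S : Fin K → Matrix (Fin 2) (Fin 2) F), (∀ l, (S l).IsSymm) → Function.Injective d →
        (∀ z x w : Fin K, x ≠ w → d x + d w = d z + d z →
          v (S z 0 0 * S z 1 1 - S z 0 1 * S z 0 1)
              ≤ v ((Matrix.det (∑ l, ((X : F[X]) ^ d l) • (S l).map (C : F →+* F[X]))).coeff (d z + d z)) ∧
            v (S x 0 0 * S w 1 1 + S w 0 0 * S x 1 1 - 2 * S x 0 1 * S w 0 1)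
              ≤ v ((Matrix.det (∑ l, ((X : F[X]) ^ d l) • (S l).map (C : F →+* F[X]))).coeff (d z + d z))) →
        ((Matrix.det (∑ l, ((X : F[X]) ^ d l) • (S l).map (C : F →+* F[X]))).support.filter fun E =>
            ∃ r : ℝ, 0 < r ∧ ∀ E' ∈ (Matrix.det (∑ l, ((X : F[X]) ^ d l) • (S l).map (C : F →+* F[X]))).support, E' ≠ E →
              v ((Matrix.det (∑ l, ((X : F[X]) ^ d l) • (S l).map (C : F →+* F[X]))).coeff E') * r ^ E'
                < v ((Matrix.det (∑ l, ((X : F[X]) ^ d l) • (S l).map (C : F →+* F[X]))).coeff E) * r ^ E).card - 1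
          ≤ 3 * K - 4 := by
  intro F _ v hv K d S hS hdinj hT
  set σ : Equiv.Perm (Fin K) := Tuple.sort d with hσ
  have hmono : StrictMono (d ∘ σ) := (Tuple.monotone_sort d).strictMono_of_injective (hdinj.comp σ.injective)
  have hS' : ∀ l, (S (σ l)).IsSymm := fun l => hS (σ l)
  have hf' : Matrix.det (∑ l, ((X : F[X]) ^ (d ∘ σ) l) • (S (σ l)).map (C : F →+* F[X]))
      = Matrix.det (∑ l, ((X : F[X]) ^ d l) • (S l).map (C : F →+* F[X])) :=
    congrArg Matrix.det (Equiv.sum_comp σ (fun l => ((X : F[X]) ^ d l) • (S l).map (C : F →+* F[X])))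
  have hT' : ∀ z x w : Fin K, x < w → (d ∘ σ) x + (d ∘ σ) w = (d ∘ σ) z + (d ∘ σ) z →
      v (S (σ z) 0 0 * S (σ z) 1 1 - S (σ z) 0 1 * S (σ z) 0 1)
          ≤ v ((Matrix.det (∑ l, ((X : F[X]) ^ (d ∘ σ) l) • (S (σ l)).map (C : F →+* F[X]))).coeff ((d ∘ σ) z + (d ∘ σ) z)) ∧
        v (S (σ x) 0 0 * S (σ w) 1 1 + S (σ w) 0 0 * S (σ x) 1 1 - 2 * S (σ x) 0 1 * S (σ w) 0 1)
          ≤ v ((Matrix.det (∑ l, ((X : F[X]) ^ (d ∘ σ) l) • (S (σ l)).map (C : F →+* F[X]))).coeff ((d ∘ σ) z + (d ∘ σ) z)) := by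
    intro z x w hxw h
    rw [hf']
    exact hT (σ z) (σ x) (σ w) (fun h0 => (ne_of_lt hxw) (σ.injective h0)) h
  have h := domCount_le_of_tame_sorted v hv (d ∘ σ) hmono (fun l => S (σ l)) hS' hT'
  rw [hf'] at h
  omega

end Summit.ValiantsHypothesis.ValiantsHypothesis.Theorems.KPlusLogSqLaw.ValDoor
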